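import Summits.BirchSwinnertonDyer.BirchSwinnertonDyer.Theorems.AlignedTransportAtTwoMainConjectureTransportAlignedAtTwoSharedCubicTorsion
import Summits.BirchSwinnertonDyer.BirchSwinnertonDyer.Theorems.TwoAdicConverseFrobeniusParityTwoDivisionRoot
import Summits.BirchSwinnertonDyer.BirchSwinnertonDyer.Theorems.AlignedTransportAtTwoMainConjectureTransportAlignedAtTwoDeltaPosCongruenceInputs
import Literature.NumberTheory.EllipticCurves.LocalTorsionMultiplicativeProofs
import Mathlib.NumberTheory.Padics.Hensel
import HarnessLib

/-!
# Crux C1 `MainConjectureTransportAlignedAtTwo` (stmt-BirchSwinnertonDyer-22296), line `birth`, residual (R2) `stub_lamLawKilford`, UNEQUAL conductors: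
# THE LEVEL-RAISING PARITY AT `2` — `a_q(W₁)` IS EVEN when `W₁` is good and `W₂` multiplicative at an odd prime `q` and the two curves share
# their cubic field (Kraus–Oesterlé 1992 Prop. 3 / Ribet's level-raising condition `a_q ≡ ±(q+1)` read mod `2`) — the hypothesis `hKO` of the
# cross-level reductions `…KilfordCopyCrossLevel{Shapes,SquarefreeConductor,Semistable}`, PROVED (width seat att-p3 g18; `--supports 22296`)

THEOREMS ONLY (no `def`, no `sorry`, no named fact). Elementary proof, no Galois representations: (§1) the `2`-division cubic
`ψ(x) = 4x³ + b₂x² + 2b₄x + b₆` of a NODAL Weierstrass cubic over a perfect field of characteristic `≠ 2` has a simple rational root (the rational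
singular point `x₀` of `Literature…SingularCubicPointCountProofs.exists_singularPoint_of_perfectField` is a double root; the third root is
`x₁ = −(8x₀ + b₂)/4`, simple because `4ψ'(x₁) = c₄ ≠ 0`); (§2) for `W₂` multiplicative at `q` (minimal model: `q ∣ Δ`, `q ∤ c₄`) Hensel lifts it to a root
of `ψ_{W₂}` in `ℤ_q`, i.e. a root of the `u`-cubic of `W₂` in `ℚ_q`; (§3) the shared cubic field `F = ℚ(e₂)` (`minpoly e₂ =` the `u`-cubic, att-p1 g0/g9's
bridge) therefore embeds in `ℚ_q`, the image of `e₁` is a root of the `u`-cubic of `W₁`, `q`-integral (monic integer cubic), and reduces to a root of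
`ψ_{W₁}` mod `q`; (§4) by cell bsd-2adic's `even_frobeniusTrace_iff_exists_root`, `a_q(W₁)` is even. §5: the conductor-currency corollaries used by the
cross-level wrappers (`q ∥ N(W₂)`, `q ∤ N(W₁)`).

BSD is not proved by this; C1 is not closed by this. With this file the cross-level reduction of (R2) for the semistable shapes depends on PLANE(2) at the
common level ALONE (sequel `…KilfordCopyCrossLevelPlaneOnly`).

References: Kraus–Oesterlé 1992 Prop. 3 [KrausOesterle1992]; Ribet 1990 (level raising, `a_q ≡ ±(q+1)`) [Ribet1990RaisingLevels]; Silverman AEC III.1.4,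
VII.5.1, VIII.8 [SilvermanAEC2009].
-/

noncomputable section

-- justification: the `Summit.BirchSwinnertonDyer.BirchSwinnertonDyer.…` path repeats a component (route-file convention)
set_option linter.dupNamespace false
set_option autoImplicit false

open scoped Classical IntermediateField
open Polynomial WeierstrassCurve Module
open Literature.NumberTheory.EllipticCurves Literature.NumberTheory.EllipticCurves.Greenberg1999
open Summit.BirchSwinnertonDyer.Rank1Residual.F1Sign2
open Summit.BirchSwinnertonDyer.BirchSwinnertonDyer.Theorems.AlignedTransportAtTwoBridge
open Summit.BirchSwinnertonDyer.BirchSwinnertonDyer.Theorems.AlignedTransportAtTwoSharedCubicTorsion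
open Summit.BirchSwinnertonDyer.BirchSwinnertonDyer.Theorems.TwoAdicTwistConverse (even_frobeniusTrace_iff_exists_root)
open Summit.BirchSwinnertonDyer.BirchSwinnertonDyer.Theorems.AlignedTransportAtTwoDeltaPosCongruenceInputs (odd_LFunction_iff_hasMultiplicativeReductionAtPrime)

namespace Summit.BirchSwinnertonDyer.BirchSwinnertonDyer.Theorems.AlignedTransportAtTwoKilfordCopyLevelRaisingParity

/-! ## §1 A nodal cubic: the `2`-division cubic has a simple rational root -/

/-- **The `2`-division cubic of a nodal Weierstrass cubic has a simple rational root** (perfect field, `2 ≠ 0`, `Δ = 0`, `c₄ ≠ 0`): with `(x₀, y₀)` the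
rational singular point, `x₀` is a double root of `ψ = 4x³ + b₂x² + 2b₄x + b₆` and `x₁ = −(8x₀ + b₂)/4` is a root with `4ψ'(x₁) = c₄ ≠ 0`.
[cite: SilvermanAEC2009, Prop. III.1.4 (a)] -/
theorem exists_simpleRoot_twoDivision_of_nodal {k : Type*} [Field k] [PerfectField k] (V : WeierstrassCurve k) (h2 : (2 : k) ≠ 0)
    (hΔ : V.Δ = 0) (hc₄ : V.c₄ ≠ 0) :
    ∃ x : k, 4 * x ^ 3 + V.b₂ * x ^ 2 + 2 * V.b₄ * x + V.b₆ = 0 ∧ 12 * x ^ 2 + 2 * V.b₂ * x + 2 * V.b₄ ≠ 0 := by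
  obtain ⟨x₀, y₀, hE, hX, hY⟩ := V.exists_singularPoint_of_perfectField hΔ
  rw [WeierstrassCurve.Affine.equation_iff] at hE
  have hb₂ : V.b₂ = V.a₁ ^ 2 + 4 * V.a₂ := rfl
  have hb₄ : V.b₄ = 2 * V.a₄ + V.a₁ * V.a₃ := rfl
  have hb₆ : V.b₆ = V.a₃ ^ 2 + 4 * V.a₆ := rfl
  have hc₄' : V.c₄ = V.b₂ ^ 2 - 24 * V.b₄ := rfl
  -- `x₀` is a double root of `ψ`
  have hψ₀ : 4 * x₀ ^ 3 + V.b₂ * x₀ ^ 2 + 2 * V.b₄ * x₀ + V.b₆ = 0 := by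
    rw [hb₂, hb₄, hb₆]; linear_combination (-4) * hE + (2 * y₀ + V.a₁ * x₀ + V.a₃) * hY
  have hψ₀' : 12 * x₀ ^ 2 + 2 * V.b₂ * x₀ + 2 * V.b₄ = 0 := by
    rw [hb₂, hb₄]; linear_combination (-4) * hX + (2 * V.a₁) * hY
  have h4 : (4 : k) ≠ 0 := by
    have : (4 : k) = 2 * 2 := by norm_num
    rw [this]; exact mul_ne_zero h2 h2
  -- the third root
  set x₁ : k := -(8 * x₀ + V.b₂) / 4 with hx₁
  have hx₁' : 4 * x₁ + 8 * x₀ + V.b₂ = 0 := by rw [hx₁]; field_simp; ring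
  refine ⟨x₁, ?_, ?_⟩
  · linear_combination hψ₀ + (x₁ - x₀) * hψ₀' + (x₁ - x₀) ^ 2 * hx₁'
  · have key : 4 * (12 * x₁ ^ 2 + 2 * V.b₂ * x₁ + 2 * V.b₄) = V.c₄ := by
      rw [hc₄']; linear_combination 16 * hψ₀' + (12 * x₁ - 24 * x₀ - V.b₂) * hx₁'
    intro h
    rw [h, mul_zero] at key
    exact hc₄ key.symm

/-! ## §2 `W₂` multiplicative at `q`: a `q`-adic root of its `u`-cubic (Hensel) -/

/-- **A curve with multiplicative reduction at an odd prime `q` has a root of its `u`-cubic `u³ + b₂u² + 8b₄u + 16b₆` in `ℚ_q`** (globally minimal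
model: `q ∣ Δ`, `q ∤ c₄`, so `ψ` is nodal mod `q` (§1); Hensel lifts the simple root; `u = 4x`). [cite: SilvermanAEC2009, Prop. VII.5.1 (b)] -/
theorem exists_padic_root_twoDivisionUCubic_of_hasMultiplicativeReductionAtPrime (W : WeierstrassCurve ℚ) [W.IsElliptic] [W.IsGloballyMinimal]
    {q : ℕ} [Fact q.Prime] (hq2 : q ≠ 2) (hm : W.HasMultiplicativeReductionAtPrime q) :
    ∃ u : ℚ_[q], aeval u (twoDivisionUCubic W) = 0 := by
  obtain ⟨hΔ, hc₄⟩ := LocalTorsionMult.dvd_Δ_and_not_dvd_c₄_integralModelInt_of_mult W q hm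
  set M : WeierstrassCurve ℤ := integralModelInt W with hM
  -- nodal reduction mod `q`
  set V : WeierstrassCurve (ZMod q) := M.map (Int.castRingHom (ZMod q)) with hV
  have hΔV : V.Δ = 0 := by rw [hV, map_Δ, eq_intCast, ZMod.intCast_zmod_eq_zero_iff_dvd]; exact hΔ
  have hc₄V : V.c₄ ≠ 0 := by rw [hV, map_c₄, eq_intCast, ne_eq, ZMod.intCast_zmod_eq_zero_iff_dvd]; exact hc₄
  have h2F : (2 : ZMod q) ≠ 0 := by
    intro h
    have h' : ((2 : ℕ) : ZMod q) = 0 := by exact_mod_cast h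
    rw [ZMod.natCast_eq_zero_iff] at h'
    exact hq2 ((Nat.prime_dvd_prime_iff_eq Fact.out Nat.prime_two).mp h')
  obtain ⟨x, hx, hx'⟩ := exists_simpleRoot_twoDivision_of_nodal V h2F hΔV hc₄V
  simp only [hV, map_b₂, map_b₄, map_b₆, eq_intCast] at hx hx'
  -- Hensel in `ℤ_q`
  set P : Polynomial ℤ := C 4 * X ^ 3 + C M.b₂ * X ^ 2 + C (2 * M.b₄) * X + C M.b₆ with hP
  have hPe : ∀ a : ℤ_[q], P.aeval a = 4 * a ^ 3 + (M.b₂ : ℤ_[q]) * a ^ 2 + 2 * (M.b₄ : ℤ_[q]) * a + (M.b₆ : ℤ_[q]) := by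
    intro a
    simp only [hP, map_add, map_mul, map_pow, aeval_X, map_intCast, map_ofNat, eq_intCast]
  have hPd : ∀ a : ℤ_[q], P.derivative.aeval a = 12 * a ^ 2 + 2 * (M.b₂ : ℤ_[q]) * a + 2 * (M.b₄ : ℤ_[q]) := by
    intro a
    have hd : P.derivative = C 12 * X ^ 2 + C (2 * M.b₂) * X + C (2 * M.b₄) := by
      simp only [hP, derivative_add, derivative_mul, derivative_C, zero_mul, zero_add, add_zero, derivative_X_pow,
        derivative_X, mul_one, map_mul, C_eq_natCast]
      norm_num
      ring
    rw [hd]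
    simp only [map_add, map_mul, map_pow, aeval_X, map_intCast, map_ofNat, eq_intCast]
  set a : ℤ_[q] := (x.val : ℤ_[q]) with ha
  have hax : PadicInt.toZMod a = x := by rw [ha, map_natCast, ZMod.natCast_zmod_val]
  have hval : ‖P.aeval a‖ < 1 := by
    rw [← PadicInt.mem_nonunits, ← IsLocalRing.mem_maximalIdeal, ← PadicInt.ker_toZMod, RingHom.mem_ker, hPe]
    simp only [map_add, map_mul, map_pow, map_intCast, map_ofNat, hax]
    linear_combination hx
  have hder : ‖P.derivative.aeval a‖ = 1 := by
    refine le_antisymm (PadicInt.norm_le_one _) (not_lt.mp fun hlt ↦ hx' ?_)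
    rw [← PadicInt.mem_nonunits, ← IsLocalRing.mem_maximalIdeal, ← PadicInt.ker_toZMod, RingHom.mem_ker, hPd] at hlt
    simp only [map_add, map_mul, map_pow, map_intCast, map_ofNat, hax] at hlt
    linear_combination hlt
  obtain ⟨z, hz, -⟩ := hensels_lemma (F := P) (a := a) (by rw [hder, one_pow]; exact hval)
  rw [hPe] at hz
  -- `u = 4 z`
  refine ⟨4 * (z : ℚ_[q]), ?_⟩
  have hb₂ : W.b₂ = (M.b₂ : ℚ) := by
    have h := congrArg WeierstrassCurve.b₂ (map_integralModelInt W); rw [map_b₂, eq_intCast] at h; exact h.symm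
  have hb₄ : W.b₄ = (M.b₄ : ℚ) := by
    have h := congrArg WeierstrassCurve.b₄ (map_integralModelInt W); rw [map_b₄, eq_intCast] at h; exact h.symm
  have hb₆ : W.b₆ = (M.b₆ : ℚ) := by
    have h := congrArg WeierstrassCurve.b₆ (map_integralModelInt W); rw [map_b₆, eq_intCast] at h; exact h.symm
  have hz' : (4 : ℚ_[q]) * (z : ℚ_[q]) ^ 3 + (M.b₂ : ℚ_[q]) * (z : ℚ_[q]) ^ 2 + 2 * (M.b₄ : ℚ_[q]) * (z : ℚ_[q]) + (M.b₆ : ℚ_[q]) = 0 := by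
    have h := congrArg (PadicInt.Coe.ringHom (p := q)) hz
    simp only [map_add, map_mul, map_pow, map_intCast, map_ofNat, map_zero, PadicInt.Coe.ringHom_apply] at h
    linear_combination h
  rw [aeval_twoDivisionUCubic, hb₂, hb₄, hb₆]
  simp only [eq_ratCast, Rat.cast_intCast, Rat.cast_mul, Rat.cast_ofNat]
  linear_combination 16 * hz'

/-! ## §3 A `q`-adic root of a `u`-cubic is `q`-integral and reduces to a root of `ψ` mod `q` -/

/-- **A root in `ℚ_q` of the (monic, integral) `u`-cubic of a globally minimal `W` reduces to a root of `ψ_W = 4x³ + b₂x² + 2b₄x + b₆` mod `q`**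
(`q` odd; `‖u‖ ≤ 1` by the ultrametric inequality, then reduce `u/4`). [cite: SilvermanAEC2009, VIII.8] -/
theorem exists_zmod_root_of_padic_root_twoDivisionUCubic (W : WeierstrassCurve ℚ) [W.IsGloballyMinimal] {q : ℕ} [Fact q.Prime] (hq2 : q ≠ 2)
    {u : ℚ_[q]} (hu : aeval u (twoDivisionUCubic W) = 0) :
    ∃ x : ZMod q, 4 * x ^ 3 + ((integralModelInt W).b₂ : ZMod q) * x ^ 2 + 2 * ((integralModelInt W).b₄ : ZMod q) * x +
      ((integralModelInt W).b₆ : ZMod q) = 0 := by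
  set M : WeierstrassCurve ℤ := integralModelInt W with hM
  have hb₂ : W.b₂ = (M.b₂ : ℚ) := by
    have h := congrArg WeierstrassCurve.b₂ (map_integralModelInt W); rw [map_b₂, eq_intCast] at h; exact h.symm
  have hb₄ : W.b₄ = (M.b₄ : ℚ) := by
    have h := congrArg WeierstrassCurve.b₄ (map_integralModelInt W); rw [map_b₄, eq_intCast] at h; exact h.symm
  have hb₆ : W.b₆ = (M.b₆ : ℚ) := by
    have h := congrArg WeierstrassCurve.b₆ (map_integralModelInt W); rw [map_b₆, eq_intCast] at h; exact h.symm
  rw [aeval_twoDivisionUCubic, hb₂, hb₄, hb₆] at hu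
  simp only [eq_ratCast, Rat.cast_intCast, Rat.cast_mul, Rat.cast_ofNat] at hu
  -- `‖u‖ ≤ 1`
  have hn : ∀ z : ℤ, ‖(z : ℚ_[q])‖ ≤ 1 := fun z ↦ Padic.norm_int_le_one z
  have hu1 : ‖u‖ ≤ 1 := by
    by_contra h
    have h : 1 < ‖u‖ := not_le.mp h
    have hpos : 0 < ‖u‖ := lt_trans zero_lt_one h
    have heq : u ^ 3 = -((M.b₂ : ℚ_[q]) * u ^ 2 + 8 * (M.b₄ : ℚ_[q]) * u + 16 * (M.b₆ : ℚ_[q])) := by linear_combination hu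
    have h8 : ‖(8 : ℚ_[q])‖ ≤ 1 := by exact_mod_cast hn 8
    have h16 : ‖(16 : ℚ_[q])‖ ≤ 1 := by exact_mod_cast hn 16
    have hA : ‖(M.b₂ : ℚ_[q]) * u ^ 2‖ ≤ ‖u‖ ^ 2 := by
      rw [norm_mul, norm_pow]; exact mul_le_of_le_one_left (pow_nonneg (norm_nonneg _) 2) (hn _)
    have hB : ‖8 * (M.b₄ : ℚ_[q]) * u‖ ≤ ‖u‖ ^ 2 := by
      rw [norm_mul, norm_mul]
      calc ‖(8 : ℚ_[q])‖ * ‖(M.b₄ : ℚ_[q])‖ * ‖u‖ ≤ 1 * 1 * ‖u‖ := by gcongr; exact hn _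
        _ = ‖u‖ := by ring
        _ ≤ ‖u‖ ^ 2 := by nlinarith
    have hC : ‖16 * (M.b₆ : ℚ_[q])‖ ≤ ‖u‖ ^ 2 := by
      rw [norm_mul]
      calc ‖(16 : ℚ_[q])‖ * ‖(M.b₆ : ℚ_[q])‖ ≤ 1 * 1 := by gcongr; exact hn _
        _ ≤ ‖u‖ ^ 2 := by nlinarith
    have hR : ‖(M.b₂ : ℚ_[q]) * u ^ 2 + 8 * (M.b₄ : ℚ_[q]) * u + 16 * (M.b₆ : ℚ_[q])‖ ≤ ‖u‖ ^ 2 :=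
      (Padic.nonarchimedean _ _).trans (max_le ((Padic.nonarchimedean _ _).trans (max_le hA hB)) hC)
    have h3 : ‖u‖ ^ 3 ≤ ‖u‖ ^ 2 := by
      rw [← norm_pow, heq, norm_neg]; exact hR
    have h4 : ‖u‖ ^ 2 * 1 < ‖u‖ ^ 2 * ‖u‖ := mul_lt_mul_of_pos_left h (by positivity)
    nlinarith
  -- reduce mod `q`
  set w : ℤ_[q] := ⟨u, hu1⟩ with hw
  have hwu : (w : ℚ_[q]) = u := rfl
  have hinj : Function.Injective (PadicInt.Coe.ringHom (p := q)) := Subtype.val_injective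
  have hw0 : w ^ 3 + (M.b₂ : ℤ_[q]) * w ^ 2 + 8 * (M.b₄ : ℤ_[q]) * w + 16 * (M.b₆ : ℤ_[q]) = 0 := by
    apply hinj
    simp only [map_add, map_mul, map_pow, map_intCast, map_ofNat, map_zero, PadicInt.Coe.ringHom_apply, hwu]
    linear_combination hu
  have hy := congrArg (PadicInt.toZMod (p := q)) hw0
  simp only [map_add, map_mul, map_pow, map_intCast, map_ofNat, map_zero] at hy
  have h2F : (2 : ZMod q) ≠ 0 := by
    intro h
    have h' : ((2 : ℕ) : ZMod q) = 0 := by exact_mod_cast h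
    rw [ZMod.natCast_eq_zero_iff] at h'
    exact hq2 ((Nat.prime_dvd_prime_iff_eq Fact.out Nat.prime_two).mp h')
  have h4 : (4 : ZMod q) ≠ 0 := by
    have : (4 : ZMod q) = 2 * 2 := by norm_num
    rw [this]; exact mul_ne_zero h2F h2F
  have h16 : (16 : ZMod q) ≠ 0 := by
    have : (16 : ZMod q) = 4 * 4 := by norm_num
    rw [this]; exact mul_ne_zero h4 h4
  refine ⟨PadicInt.toZMod w / 4, ?_⟩
  set y := PadicInt.toZMod w with hydef
  have hxy : 4 * (y / 4) = y := mul_div_cancel₀ y h4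
  have : 16 * (4 * (y / 4) ^ 3 + (M.b₂ : ZMod q) * (y / 4) ^ 2 + 2 * (M.b₄ : ZMod q) * (y / 4) + (M.b₆ : ZMod q)) = 0 := by
    have e : 16 * (4 * (y / 4) ^ 3 + (M.b₂ : ZMod q) * (y / 4) ^ 2 + 2 * (M.b₄ : ZMod q) * (y / 4) + (M.b₆ : ZMod q)) =
        (4 * (y / 4)) ^ 3 + (M.b₂ : ZMod q) * (4 * (y / 4)) ^ 2 + 8 * (M.b₄ : ZMod q) * (4 * (y / 4)) + 16 * (M.b₆ : ZMod q) := by ring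
    rw [e, hxy]; exact hy
  exact (mul_eq_zero.mp this).resolve_left h16

/-! ## §4 The level-raising parity at `2` (Kraus–Oesterlé Prop. 3 at `p = 2`) -/

/-- **`a_q(W₁)` is EVEN when `W₁` is good and `W₂` multiplicative at the odd prime `q` and the two curves (no rational `2`-torsion abscissa) share a
cubic field `F ∋ e₁, e₂` of their `u`-cubics** (`W₂` without rational `2`-torsion abscissa). (The `u`-cubic of `W₂` has a root in `ℚ_q` (§2), so `F = ℚ(e₂)` embeds in `ℚ_q`; the image of `e₁` is a
`q`-integral root of the `u`-cubic of `W₁`, whose reduction is a root of `ψ_{W₁}` mod `q` (§3); `a_q` even ⟺ `ψ` has a root mod `q`.) This is the mod-`2`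
level-raising condition `a_q(W₁) ≡ ±(q+1) ≡ 0`. [cite: KrausOesterle1992, Prop. 3 (p. 262–263)] [cite: Ribet1990RaisingLevels, Thm. 1 (necessity)]
[cite: SilvermanAEC2009, III.2.3 and V.2.3.1] -/
theorem even_LFunction_of_sharedCubicField_of_hasMultiplicativeReductionAtPrime
    (W₁ W₂ : WeierstrassCurve ℚ) [W₁.IsElliptic] [W₁.IsGloballyMinimal] [W₂.IsElliptic] [W₂.IsGloballyMinimal]
    {F : Type*} [Field F] [NumberField F] (hF : finrank ℚ F = 3)
    (ht₂ : ∀ x : ℚ, ¬ HasRationalTwoTorsionX W₂ x)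
    {e₁ e₂ : F} (he₁ : aeval e₁ (twoDivisionUCubic W₁) = 0) (he₂ : aeval e₂ (twoDivisionUCubic W₂) = 0)
    {q : ℕ} (hq : q.Prime) (hq2 : q ≠ 2) (hq₁ : ¬ q ∣ W₁.conductorNorm ℤ) (hm₂ : haveI : Fact q.Prime := ⟨hq⟩; W₂.HasMultiplicativeReductionAtPrime q) :
    Even (W₁.LFunction q) := by
  haveI : Fact q.Prime := ⟨hq⟩
  -- §2: a `q`-adic root of the `u`-cubic of `W₂`, hence an embedding `F → ℚ_q`
  obtain ⟨u₂, hu₂⟩ := exists_padic_root_twoDivisionUCubic_of_hasMultiplicativeReductionAtPrime W₂ hq2 hm₂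
  have hint : IsIntegral ℚ e₂ := Algebra.IsIntegral.isIntegral e₂
  have hmin : minpoly ℚ e₂ = twoDivisionUCubic W₂ := minpoly_eq_twoDivisionUCubic W₂ ht₂ he₂
  have hmem : u₂ ∈ (minpoly ℚ e₂).aroots ℚ_[q] := by
    rw [mem_aroots, hmin]
    exact ⟨(monic_twoDivisionUCubic W₂).ne_zero, hu₂⟩
  set φ₀ : ℚ⟮e₂⟯ →ₐ[ℚ] ℚ_[q] := (IntermediateField.algHomAdjoinIntegralEquiv ℚ hint).symm ⟨u₂, hmem⟩ with hφ₀
  have htop : ℚ⟮e₂⟯ = ⊤ := adjoin_root_eq_top W₂ hF ht₂ he₂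
  set ι : F ≃ₐ[ℚ] ℚ⟮e₂⟯ := (IntermediateField.topEquiv.symm.trans (IntermediateField.equivOfEq htop).symm) with hι
  set φ : F →ₐ[ℚ] ℚ_[q] := φ₀.comp ι.toAlgHom with hφ
  -- §3: the image of `e₁` is a root of the `u`-cubic of `W₁` in `ℚ_q`, reducing to a root of `ψ_{W₁}` mod `q`
  have hv : aeval (φ e₁) (twoDivisionUCubic W₁) = 0 := by rw [aeval_algHom_apply, he₁, map_zero]
  obtain ⟨x, hx⟩ := exists_zmod_root_of_padic_root_twoDivisionUCubic W₁ hq2 hv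
  -- §4: `a_q(W₁)` is even
  have hgood : W₁.HasGoodReductionAtPrime q := hasGoodReductionAtPrime_of_not_dvd_conductorNorm W₁ hq₁
  rw [LFunction_apply_prime_eq_frobeniusTrace W₁ q hgood, even_frobeniusTrace_iff_exists_root W₁ q hq2 hgood]
  exact ⟨x, hx⟩

/-! ## §5 In the conductor / `LFunction` currency of the cross-level wrappers -/

/-- **`a_q(W₁)` is even when `q ∤ N(W₁)`, `q ∣ N(W₂)` with `a_q(W₂)` odd (i.e. `W₂` multiplicative at `q`), `q` odd, and the curves share their cubic
field** — the `hKO` input of `…KilfordCopyCrossLevel{Shapes,SquarefreeConductor,Semistable}` in their own currency.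
[cite: KrausOesterle1992, Prop. 3 (p. 262–263)] [cite: SilvermanAEC2009, Exercise 8.19 (a) and §C.16] -/
theorem even_LFunction_of_sharedCubicField_of_odd_LFunction
    (W₁ W₂ : WeierstrassCurve ℚ) [W₁.IsElliptic] [W₁.IsGloballyMinimal] [W₂.IsElliptic] [W₂.IsGloballyMinimal]
    {F : Type*} [Field F] [NumberField F] (hF : finrank ℚ F = 3)
    (ht₂ : ∀ x : ℚ, ¬ HasRationalTwoTorsionX W₂ x)
    {e₁ e₂ : F} (he₁ : aeval e₁ (twoDivisionUCubic W₁) = 0) (he₂ : aeval e₂ (twoDivisionUCubic W₂) = 0)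
    {q : ℕ} (hq : q.Prime) (hq2 : q ≠ 2) (hq₁ : ¬ q ∣ W₁.conductorNorm ℤ) (hq₂ : q ∣ W₂.conductorNorm ℤ) (hodd : Odd (W₂.LFunction q)) :
    Even (W₁.LFunction q) :=
  even_LFunction_of_sharedCubicField_of_hasMultiplicativeReductionAtPrime W₁ W₂ hF ht₂ he₁ he₂ hq hq2 hq₁
    ((odd_LFunction_iff_hasMultiplicativeReductionAtPrime W₂ hq hq₂).mp hodd)

/-- **Good reduction at `2` excludes `2` from the conductor**, so every prime of `N(W)` is odd for a curve ordinary (in particular good) at `2`.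
[cite: SilvermanAEC2009, §C.16] -/
theorem ne_two_of_dvd_conductorNorm_of_isOrdinaryAt (W : WeierstrassCurve ℚ) [W.IsElliptic] [W.IsGloballyMinimal] (hord : IsOrdinaryAt W 2)
    {q : ℕ} (hq : q ∣ W.conductorNorm ℤ) : q ≠ 2 := by
  rintro rfl
  exact (W.dvd_conductorNorm_iff_not_hasGoodReductionAtPrime 2).mp hq hord.1

end Summit.BirchSwinnertonDyer.BirchSwinnertonDyer.Theorems.AlignedTransportAtTwoKilfordCopyLevelRaisingParity

end
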